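import Literature.MathematicalPhysics.QuantumFieldTheory.YangMillsOS
import Literature.MathematicalPhysics.QuantumFieldTheory.LatticeMassGap
import Literature.Probability.LatticeModels.OSReconstruction
import HarnessLib

/-!
# Osterwalder–Schrader data of lattice gauge theory on `ℤ⁴`: bond time reflection, unit time
shift, positive-time events; odd-torus limit states; volume-uniform torus clustering and the
infinite-volume transfer gap

Definitions only (no facts, no theorems beyond `rfl`-level unfoldings). They are the vocabulary in
which "Euclidean-time clustering of the torus Wilson states ⇒ spectral gap of the reconstructed
transfer operator" (Osterwalder–Seiler 1978 §2; Seiler LNP 159 Ch. 2; Glimm–Jaffe 1987 §6.1) is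
stated for GAUGE configurations `LGConfig 4 G = (ZdEdge 4 → G)`, complementing the spin-system
data `latticeTimeReflection`, `latticeTimeShift`, `positiveTimeEvents` of `LatticeMassGap.lean`:

* `gaugeTimeReflect` — the bond time reflection `Θ` of gauge fields induced by the site reflection
  `x₀ ↦ -1 - x₀` (`latticeTimeReflection 4`): spatial links are carried along, the temporal link
  from `x` to `x + e₀` goes to the REVERSED temporal link from `θ(x + e₀)` to `θx`, whence the
  inverse (Osterwalder–Seiler 1978 §2, the reflection between the hyperplanes `x₀ = -1`, `x₀ = 0`).
* `gaugeTimeShift` — the unit Euclidean time shift `(τU)(x, i) = U(x + e₀, i)` (the sign of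
  `latticeConnectedCorr`, whose second observable is composed with `configShift (-n e₀)`).
* `posTimeEdges`, `posTimeEvents` — the links based at sites with `0 ≤ x₀` and their cylinder
  σ-algebra `𝓔₊` (Glimm–Jaffe 1987 §6.1).
* `oddTorusLimitPoints r β` — infinite-volume limit states along odd symmetric tori
  `(ℤ/(2S_k+1))⁴` (tree `IsInfiniteVolumeLimitAlong`, sides `L_k + 1 = 2 S_k + 1`).
* `TorusClusteringAt r β m` — volume-uniform exponential clustering in Euclidean time at coupling
  `β` with rate `m` on all odd symmetric tori, `n ≤ S` (the atom of the lattice mass-gap hypothesis,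
  cf. `HasLatticeMassGap`; Jaffe–Witten §5).
* `HasInfiniteVolumeGap r β m` — every odd-torus limit state is OS-reconstructible for
  `(Θ, τ, 𝓔₊)` (tree `IsOSReconstructible`) with transfer gap `‖T|_{Ω^⊥}‖ ≤ e^{-m}`
  (tree `TransferData.HasMassGap`).
* `CylinderApprox μ`, `CylinderExt G`, `contPosTimeObs G` — the measure-theoretic side conditions
  under which the OS space is generated by CONTINUOUS positive-time gauge-invariant local
  observables (approximation of bounded `𝓔₊`-measurable functions by continuous positive-time
  cylinder functions in `L²(μ)`; determination of probability measures by continuous-cylinder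
  integrals).

What is NOT here: any claim that these properties hold (they are proved, per regime, by their
users); the asymmetric-torus / transfer-matrix-trace vocabulary of finite-size bounds.

References: K. Osterwalder, E. Seiler, Ann. Phys. 110 (1978) §2 [OsterwalderSeiler1978];
E. Seiler, LNP 159 (1982) Ch. 2 [Seiler1982]; J. Glimm, A. Jaffe, Quantum Physics (1987) §6.1
[GlimmJaffe1987]; S. Chatterjee, arXiv:1803.01950 §5 [arXiv180301950].
-/

noncomputable section

open MeasureTheory Filter
open scoped Topology

namespace Literature.MathematicalPhysics.QuantumFieldTheory

open Literature.MathematicalPhysics.QuantumLattice Literature.Probability.LatticeModels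

/-! ### Time reflection, time shift, positive-time events for gauge fields on `ℤ⁴` -/

section Geometry

variable {G : Type}

/-- **Bond time reflection of `ℤ⁴` gauge fields** induced by the site reflection
`θ : x₀ ↦ -1 - x₀` (`latticeTimeReflection 4`, plane `x₀ = -1/2`): a spatial link `(x, i)`,
`i ≠ 0`, reads `U (θx, i)`; the temporal link `(x, 0)` from `x` to `x + e₀` reads the INVERSE of
the temporal link based at `θ(x + e₀) = θx - e₀` (the reflected link, traversed backwards).
`Θ` is an involution exchanging the links based at times `≥ 0` with links lying at times `≤ -1`.
[cite: OsterwalderSeiler1978, §2] -/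
def gaugeTimeReflect [Group G] (U : LGConfig 4 G) : LGConfig 4 G := fun e =>
  if e.2 = 0 then (U (latticeTimeReflection 4 (e.1 + Pi.single 0 1), 0))⁻¹
  else U (latticeTimeReflection 4 e.1, e.2)

/-- Pointwise formula for `gaugeTimeReflect`. [cite: OsterwalderSeiler1978, §2] -/
theorem gaugeTimeReflect_apply [Group G] (U : LGConfig 4 G) (e : ZdEdge 4) :
    gaugeTimeReflect U e =
      if e.2 = 0 then (U (latticeTimeReflection 4 (e.1 + Pi.single 0 1), 0))⁻¹
      else U (latticeTimeReflection 4 e.1, e.2) := rfl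

/-- **Unit Euclidean time shift of `ℤ⁴` gauge fields**, `(τU)(x, i) = U(x + e₀, i)`
(`configShift (-e₀)`; with the OS convention `ι (F ∘ τ) = T (ι F)` an observable localised at
times `≥ 0` is sent to one localised at times `≥ 1`; it is the translation composed with the
second observable of `latticeConnectedCorr`). [cite: GlimmJaffe1987, §6.1] -/
def gaugeTimeShift [MeasurableSpace G] : LGConfig 4 G → LGConfig 4 G :=
  configShift (G := G) (-(Pi.single (0 : Fin 4) (1 : ℤ)))

/-- `gaugeTimeShift U (x, i) = U (x + e₀, i)`. [cite: GlimmJaffe1987, §6.1] -/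
@[simp] theorem gaugeTimeShift_apply [MeasurableSpace G] (U : LGConfig 4 G) (e : ZdEdge 4) :
    gaugeTimeShift U e = U (e.1 + Pi.single 0 1, e.2) := by
  simp [gaugeTimeShift, sub_neg_eq_add]

/-- **Positive-time links**: those based at sites with `0 ≤ x₀` (spatial links at times `≥ 0`,
temporal links from `t ≥ 0` upwards; the temporal links from `-1` to `0` belong to neither half).
[cite: OsterwalderSeiler1978, §2] -/
def posTimeEdges : Set (ZdEdge 4) := {e | 0 ≤ e.1 0}

/-- Membership in `posTimeEdges`. [cite: OsterwalderSeiler1978, §2] -/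
@[simp] theorem mem_posTimeEdges {e : ZdEdge 4} : e ∈ posTimeEdges ↔ 0 ≤ e.1 0 := Iff.rfl

variable (G) in
/-- **The positive-time σ-algebra `𝓔₊`** of gauge fields: cylinder events of `posTimeEdges`
(Mathlib `cylinderEvents`, through the tree's `positiveEvents`). [cite: GlimmJaffe1987, §6.1] -/
abbrev posTimeEvents [MeasurableSpace G] : MeasurableSpace (LGConfig 4 G) :=
  positiveEvents (S := G) posTimeEdges

end Geometry

/-! ### Odd-torus limit states, torus clustering, infinite-volume gap -/

section States

variable {G : Type} [Group G] [MeasurableSpace G] [TopologicalSpace G] [IsTopologicalGroup G]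
  [CompactSpace G] [BorelSpace G]

/-- **Infinite-volume limit states along ODD symmetric tori** `(ℤ/(2S_k+1))⁴`, `S_k` strictly
increasing (tree `IsInfiniteVolumeLimitAlong` with sides `L_k + 1 = 2 S_k + 1`): the tori on which
torus clustering hypotheses `n ≤ S` are stated. [cite: arXiv180301950, §2] -/
def oddTorusLimitPoints (r : LatticeRep G) (β : ℝ) : Set (Measure (LGConfig 4 G)) :=
  {μ | ∃ S : ℕ → ℕ, StrictMono S ∧ IsInfiniteVolumeLimitAlong (d := 4) r.ρ β (fun k => 2 * S k) μ}

/-- **Volume-uniform Euclidean-time clustering at coupling `β` with rate `m`**: for every pair of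
gauge-invariant local observables a constant `C(A, B)` such that on EVERY odd symmetric torus of
side `2S+1` and for all time separations `n ≤ S`,
`|⟨A · τ_{n e₀} B⟩_{β,2S+1} − ⟨A⟩⟨B⟩| ≤ C e^{-m n}` (the atom of `HasLatticeMassGap`;
Jaffe–Witten §5 "uniform gap for finite-volume approximations"). [cite: arXiv180301950, §5 Problem 5.1] -/
def TorusClusteringAt (r : LatticeRep G) (β m : ℝ) : Prop :=
  ∀ A B : YMSpecies G, ∃ C : ℝ, ∀ S n : ℕ, n ≤ S →
    |latticeConnectedCorr r.ρ β (2 * S + 1) A.F B.F n| ≤ C * Real.exp (-(m * n))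

/-- **Infinite-volume transfer gap `≥ m` at coupling `β`**: every odd-torus limit state is
Osterwalder–Schrader reconstructible for the bond time reflection, the unit time shift and `𝓔₊`
(tree `IsOSReconstructible`: RP, RP half a step up, hermitian and shift symmetry), and its
reconstructed transfer data satisfy `‖T|_{Ω^⊥}‖ ≤ e^{-m}` (tree `TransferData.HasMassGap`)
(Osterwalder–Seiler 1978 §2; Glimm–Jaffe 1987 Thm. 6.1.3). [cite: OsterwalderSeiler1978, §2] -/
def HasInfiniteVolumeGap (r : LatticeRep G) (β m : ℝ) : Prop :=
  ∀ (μ : Measure (LGConfig 4 G)) [IsProbabilityMeasure μ], μ ∈ oddTorusLimitPoints r β →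
    ∃ h : IsOSReconstructible μ gaugeTimeReflect gaugeTimeShift (posTimeEvents G),
      h.transferData.HasMassGap m

end States

/-! ### Measure-theoretic side conditions on the configuration space -/

section MeasureTheory

variable {G : Type} [MeasurableSpace G] [TopologicalSpace G]

/-- **Approximation property of a measure on `ℤ⁴` gauge fields**: every bounded
`𝓔₊`-measurable complex observable is an `L²(μ)`-limit of CONTINUOUS bounded cylinder
observables supported on finitely many positive-time links (and again `𝓔₊`-measurable). For a
probability measure on the compact metrisable configuration space this always holds (`𝓔₊` is
generated by the positive-time coordinates; continuous functions are dense in `L²` of a finite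
Borel measure on `G^Λ`). [cite: GlimmJaffe1987, §6.1] -/
def CylinderApprox (μ : Measure (LGConfig 4 G)) : Prop :=
  ∀ F : LGConfig 4 G → ℂ, IsBoundedMeasurable (posTimeEvents G) F → ∀ ε : ℝ, 0 < ε →
    ∃ (F' : LGConfig 4 G → ℂ) (Λ : Finset (ZdEdge 4)), (↑Λ : Set (ZdEdge 4)) ⊆ posTimeEdges ∧
      IsCylinder F' Λ ∧ Continuous F' ∧ Measurable[posTimeEvents G] F' ∧
        (∃ C : ℝ, ∀ U, ‖F' U‖ ≤ C) ∧ ∫ U, ‖F U - F' U‖ ^ 2 ∂μ ≤ ε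

variable (G) in
/-- **Probability measures on `ℤ⁴` gauge fields are determined by their integrals of bounded
continuous real cylinder observables** (as a property of `G`; true for compact metrisable `G` by
Stone–Weierstrass on the compact configuration space and uniqueness of finite Borel measures).
[cite: GlimmJaffe1987, §6.1] -/
def CylinderExt : Prop :=
  ∀ (μ ν : Measure (LGConfig 4 G)) [IsProbabilityMeasure μ] [IsProbabilityMeasure ν],
    (∀ (F : LGConfig 4 G → ℝ) (Λ : Finset (ZdEdge 4)), IsCylinder F Λ → Continuous F →
      (∃ C : ℝ, ∀ U, |F U| ≤ C) → ∫ U, F U ∂μ = ∫ U, F U ∂ν) → μ = ν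

variable (G) in
/-- **The continuous positive-time species** (`G` a group) as complex observables: `U ↦ (A.F U : ℂ)` for a
gauge-invariant local observable `A : YMSpecies G` with `A.F` continuous and `A.supp ⊆ posTimeEdges`
(the generating set of the OS space of a gauge-invariant state). [cite: OsterwalderSeiler1978, §2] -/
def contPosTimeObs [Group G] : Set (LGConfig 4 G → ℂ) :=
  {F | ∃ A : YMSpecies G, Continuous A.F ∧ (↑A.supp : Set (ZdEdge 4)) ⊆ posTimeEdges ∧
    F = fun U => (A.F U : ℂ)}

end MeasureTheory

end Literature.MathematicalPhysics.QuantumFieldTheory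

end
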